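import Literature.Geometry.Lorentzian.BogovskiiVectorKernel
import Literature.Geometry.Lorentzian.BogovskiiOperator
import HarnessLib

/-!
# The Bogovskiĭ-type operator for the symmetric divergence: (T2) in weak form at the operator level

(trunk G08 = T-LORENTZ; family `gr`; namespace `Literature.Geometry.Lorentzian.MaoOhTao`.)

Mao–Oh–Tao (arXiv:2308.13031), Lemma 2.3, second part (p. 8), (T2): `∂_i (T f)^{ij} = f^j` for vector densities with
vanishing Killing moments.  `BogovskiiVectorKernel.lean` proves the weak identity with the density integrated over `y`
outside; here the `y`-integral is moved inside (Fubini on `ℝ³ × ℝ³`, as in `BogovskiiOperator.lean` for `S`), giving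
(T2) for the operator fields

  `SV^i_k(x) = ∫ w_y zⁱ/|z|³|_{z = x − y} F^k(y) dy`,  `SK^{im}_k(x) = ∫ w_y zⁱz^m/|z|³|_{z = x − y} F^k(y) dy`:

`Σ_{j,k} [ δ_{jk}(½ Σ_i ∫ SV^i_k ∂ᵢψⱼ − ½ Σ_{i,m} ∫ SK^{im}_k ∂ₘ∂ᵢψⱼ) + ½ ∫ SV^j_k ∂ₖψⱼ − ½ Σ_m ∫ SK^{jm}_k ∂ₘ∂ₖψⱼ`
`  + Σ_i ∫ SK^{ij}_k ∂ᵢ∂ₖψⱼ ] = −(∫η) Σ_j ∫ F^j ψ_j`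

(`sum_sum_bogovskiiVectorOperator_weak_eq`), i.e. `Σ_{i,j} ⟨(T F)^{ij}, ∂ᵢψⱼ⟩ = −(∫η)⟨F, ψ⟩` for the symmetric
distribution `(T F)^{ij} = A^{ij} + ∂_m B^{ijm} − ∂_k Q^{ij}_k`, `A^{ij} = ½(SV^i_j + SV^j_i)`,
`B^{ijm} = ½(SK^{im}_j + SK^{jm}_i)`, `Q^{ij}_k = SK^{ij}_k` (the `+`-sign kernel of `BogovskiiVectorKernel.lean`).
Also: `integrable_bogovskiiV_prod` (the `|z|⁻²` kernel integrand is integrable on the product) and the support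
property (T1) `support_bogovskiiVectorOperator_subset` (all kernel pieces carry the factor `w_y`).

Everything is proved; no definitions, no named facts.

## References

* Y. Mao, S.-J. Oh, T. Tao, arXiv:2308.13031 (2023), Lemma 2.3 (T1), (T2), p. 8 (key `MaoOhTao2023`).
-/

noncomputable section

open scoped RealInnerProductSpace Topology ContDiff
open Filter MeasureTheory Set Metric Function

namespace Literature.Geometry.Lorentzian

namespace MaoOhTao

variable {η : E3 → ℝ} {R : ℝ}

/-- `|vᵢ| ≤ |v|`. [folklore] -/
private theorem abs_apply_le_norm'' (v : E3) (i : Fin 3) : |v i| ≤ ‖v‖ := by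
  simpa using PiLp.norm_apply_le v i

/-- **Integrability of the vector-kernel integrand on `ℝ³ × ℝ³`.** For continuous compactly supported `f, g`,
`(x, y) ↦ w_y(x − y) (x − y)ᵢ |x − y|⁻³ f(y) g(x)` is integrable for the product measure (dominated by the convolution
integrand `W|f(y)| · M 𝟙_{B_D}(x − y)/|x − y|²`). [folklore] -/
theorem integrable_bogovskiiV_prod (hη : Continuous η) (hR : ∀ z : E3, R < ‖z‖ → η z = 0) {f g : E3 → ℝ}
    (hf : Continuous f) (hfc : HasCompactSupport f) (hg : Continuous g) (hgc : HasCompactSupport g) (i : Fin 3) :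
    Integrable (fun p : E3 × E3 ↦
      bogovskiiWeight η p.2 ‖p.1 - p.2‖ (‖p.1 - p.2‖⁻¹ • (p.1 - p.2)) *
        ((p.1 - p.2) i * (‖p.1 - p.2‖ ^ 3)⁻¹) * f p.2 * g p.1)
      ((volume : Measure E3).prod (volume : Measure E3)) := by
  obtain ⟨Rf, hRf⟩ := hfc.isCompact.isBounded.subset_closedBall 0
  obtain ⟨Rg, hRg⟩ := hgc.isCompact.isBounded.subset_closedBall 0
  obtain ⟨W, hW⟩ := exists_abs_bogovskiiWeight_le_of_norm_le hη hR Rf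
  obtain ⟨M, hM⟩ := hg.bounded_above_of_compact_support hgc
  have hM0 : 0 ≤ M := (norm_nonneg _).trans (hM 0)
  set D : ℝ := Rg + Rf with hD
  set F₁ : E3 → ℝ := fun y ↦ max W 0 * |f y| with hF₁
  set k : E3 → ℝ := fun z ↦ M * (closedBall (0 : E3) D).indicator (fun z ↦ (‖z‖ ^ 2)⁻¹) z with hk
  have hF₁i : Integrable F₁ := (continuous_const.mul hf.abs).integrable_of_hasCompactSupport hfc.abs.mul_left
  have hki : Integrable k := by
    refine Integrable.const_mul ((integrable_indicator_iff measurableSet_closedBall).2 ?_) M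
    have h : IntegrableOn (fun z : E3 ↦ (‖z‖ ^ 2)⁻¹) (ball (0 : E3) (D + 1)) :=
      integrableOn_ball_of_norm_le_rpow (by rw [finrank_euclideanSpace_fin]; norm_num) (C := 1) (α := 2)
        (by rw [finrank_euclideanSpace_fin]; norm_num)
        (Eventually.of_forall fun z ↦ by
          rw [Real.rpow_neg (norm_nonneg _), Real.rpow_two, one_mul, norm_inv, norm_pow, norm_norm])
        ((continuous_norm.measurable.pow_const 2).inv.aestronglyMeasurable)
    exact h.mono_set (closedBall_subset_ball (by linarith))
  have hdom := hF₁i.convolution_integrand (L := ContinuousLinearMap.mul ℝ ℝ) hki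
  have hcont : ContinuousOn (fun p : E3 × E3 ↦
      bogovskiiWeight η p.2 ‖p.1 - p.2‖ (‖p.1 - p.2‖⁻¹ • (p.1 - p.2)) *
        ((p.1 - p.2) i * (‖p.1 - p.2‖ ^ 3)⁻¹) * f p.2 * g p.1) {p | p.1 ≠ p.2} := by
    have hsub : Continuous fun p : E3 × E3 ↦ p.1 - p.2 := continuous_fst.sub continuous_snd
    refine (((continuousOn_bogovskiiWeight_sub hη hR).mul ?_).mul (hf.comp continuous_snd).continuousOn).mul
      (hg.comp continuous_fst).continuousOn
    refine ((EuclideanSpace.proj (𝕜 := ℝ) i).continuous.comp hsub).continuousOn.mul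
      (ContinuousOn.inv₀ ((continuous_norm.comp hsub).pow 3).continuousOn fun p hp ↦ ?_)
    exact pow_ne_zero 3 (norm_ne_zero_iff.2 (sub_ne_zero.2 hp))
  have hmeas : AEStronglyMeasurable (fun p : E3 × E3 ↦
      bogovskiiWeight η p.2 ‖p.1 - p.2‖ (‖p.1 - p.2‖⁻¹ • (p.1 - p.2)) *
        ((p.1 - p.2) i * (‖p.1 - p.2‖ ^ 3)⁻¹) * f p.2 * g p.1)
      ((volume : Measure E3).prod (volume : Measure E3)) := by
    have h := hcont.aestronglyMeasurable (μ := (volume : Measure E3).prod (volume : Measure E3))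
      (isOpen_ne_fun continuous_fst continuous_snd).measurableSet
    rwa [Measure.restrict_eq_self_of_ae_mem (s := {p : E3 × E3 | p.1 ≠ p.2}) ae_fst_ne_snd] at h
  refine hdom.mono' hmeas (Eventually.of_forall fun p ↦ ?_)
  simp only [ContinuousLinearMap.mul_apply', hF₁, hk, Real.norm_eq_abs]
  have hRHS0 : ∀ z : E3, 0 ≤ max W 0 * |f p.2| * (M * (closedBall (0 : E3) D).indicator (fun z ↦ (‖z‖ ^ 2)⁻¹) z) :=
    fun z ↦ mul_nonneg (mul_nonneg (le_max_right _ _) (abs_nonneg _))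
      (mul_nonneg hM0 (indicator_nonneg (fun z _ ↦ inv_nonneg.2 (sq_nonneg ‖z‖)) _))
  by_cases hfp : f p.2 = 0
  · have : |bogovskiiWeight η p.2 ‖p.1 - p.2‖ (‖p.1 - p.2‖⁻¹ • (p.1 - p.2)) *
        ((p.1 - p.2) i * (‖p.1 - p.2‖ ^ 3)⁻¹) * f p.2 * g p.1| = 0 := by
      rw [hfp]; simp
    rw [this]
    simpa only [hfp, abs_zero, mul_zero, zero_mul] using hRHS0 (p.1 - p.2)
  by_cases hgp : g p.1 = 0
  · have : |bogovskiiWeight η p.2 ‖p.1 - p.2‖ (‖p.1 - p.2‖⁻¹ • (p.1 - p.2)) *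
        ((p.1 - p.2) i * (‖p.1 - p.2‖ ^ 3)⁻¹) * f p.2 * g p.1| = 0 := by
      rw [hgp]; simp
    rw [this]
    exact hRHS0 (p.1 - p.2)
  have hy : ‖p.2‖ ≤ Rf := by
    have := hRf (subset_tsupport _ (mem_support.2 hfp))
    rwa [mem_closedBall, dist_zero_right] at this
  have hx : ‖p.1‖ ≤ Rg := by
    have := hRg (subset_tsupport _ (mem_support.2 hgp))
    rwa [mem_closedBall, dist_zero_right] at this
  have hzD : p.1 - p.2 ∈ closedBall (0 : E3) D := by
    rw [mem_closedBall, dist_zero_right]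
    exact (norm_sub_le _ _).trans (by linarith)
  rw [indicator_of_mem hzD]
  by_cases hz : p.1 - p.2 = 0
  · have : |bogovskiiWeight η p.2 ‖p.1 - p.2‖ (‖p.1 - p.2‖⁻¹ • (p.1 - p.2)) *
        ((p.1 - p.2) i * (‖p.1 - p.2‖ ^ 3)⁻¹) * f p.2 * g p.1| = 0 := by
      rw [hz]; simp
    rw [this]
    exact mul_nonneg (mul_nonneg (le_max_right _ _) (abs_nonneg _)) (mul_nonneg hM0 (inv_nonneg.2 (sq_nonneg _)))
  have hn : 0 < ‖p.1 - p.2‖ := norm_pos_iff.2 hz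
  have hw : |bogovskiiWeight η p.2 ‖p.1 - p.2‖ (‖p.1 - p.2‖⁻¹ • (p.1 - p.2))| ≤ max W 0 :=
    (hW p.2 hy _ _ (by rw [norm_smul, norm_inv, norm_norm, inv_mul_cancel₀ hn.ne'])).trans (le_max_left _ _)
  have hm : |(p.1 - p.2) i * (‖p.1 - p.2‖ ^ 3)⁻¹| ≤ (‖p.1 - p.2‖ ^ 2)⁻¹ := by
    rw [abs_mul, abs_inv, abs_pow, abs_norm]
    calc |(p.1 - p.2) i| * (‖p.1 - p.2‖ ^ 3)⁻¹ ≤ ‖p.1 - p.2‖ * (‖p.1 - p.2‖ ^ 3)⁻¹ :=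
          mul_le_mul_of_nonneg_right (abs_apply_le_norm'' _ i) (by positivity)
      _ = (‖p.1 - p.2‖ ^ 2)⁻¹ := by field_simp
  rw [abs_mul, abs_mul, abs_mul]
  calc |bogovskiiWeight η p.2 ‖p.1 - p.2‖ (‖p.1 - p.2‖⁻¹ • (p.1 - p.2))| *
        |(p.1 - p.2) i * (‖p.1 - p.2‖ ^ 3)⁻¹| * |f p.2| * |g p.1|
      ≤ max W 0 * (‖p.1 - p.2‖ ^ 2)⁻¹ * |f p.2| * M := by
        refine mul_le_mul (mul_le_mul (mul_le_mul hw hm (abs_nonneg _) (le_max_right _ _)) le_rfl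
          (abs_nonneg _) (by positivity)) ?_ (abs_nonneg _) (by positivity)
        rw [← Real.norm_eq_abs]; exact hM _
    _ = max W 0 * |f p.2| * (M * (‖p.1 - p.2‖ ^ 2)⁻¹) := by ring


/-! ### Fubini for the two kernel shapes -/

section Fubini

variable {f g : E3 → ℝ}

/-- **Fubini, vector kernel**: `∫ (∫ w_y(x−y)(x−y)ₐ|x−y|⁻³ f(y) dy) g(x) dx = ∫ f(y) (∫ w_y(z) zₐ|z|⁻³ g(z + y) dz) dy`,
and the `y`-sections are integrable. [folklore] -/
theorem integral_bogovskiiV_operator_mul_eq (hη : Continuous η) (hR : ∀ z : E3, R < ‖z‖ → η z = 0)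
    (hf : Continuous f) (hfc : HasCompactSupport f) (hg : Continuous g) (hgc : HasCompactSupport g) (a : Fin 3) :
    (Integrable fun y : E3 ↦ f y * ∫ z : E3, bogovskiiWeight η y ‖z‖ (‖z‖⁻¹ • z) * (z a * (‖z‖ ^ 3)⁻¹) * g (z + y)) ∧
    ∫ x : E3, (∫ y : E3, bogovskiiWeight η y ‖x - y‖ (‖x - y‖⁻¹ • (x - y)) *
        ((x - y) a * (‖x - y‖ ^ 3)⁻¹) * f y) * g x =
      ∫ y : E3, f y * ∫ z : E3, bogovskiiWeight η y ‖z‖ (‖z‖⁻¹ • z) * (z a * (‖z‖ ^ 3)⁻¹) * g (z + y) := by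
  have hpt : ∀ y : E3, ∫ x : E3, bogovskiiWeight η y ‖x - y‖ (‖x - y‖⁻¹ • (x - y)) *
      ((x - y) a * (‖x - y‖ ^ 3)⁻¹) * f y * g x =
      f y * ∫ z : E3, bogovskiiWeight η y ‖z‖ (‖z‖⁻¹ • z) * (z a * (‖z‖ ^ 3)⁻¹) * g (z + y) := by
    intro y
    rw [← integral_add_right_eq_self (μ := (volume : Measure E3)) _ y, ← integral_const_mul]
    refine integral_congr_ae (ae_of_all _ fun z ↦ ?_)
    simp only [add_sub_cancel_right]
    ring
  have hint := integrable_bogovskiiV_prod hη hR hf hfc hg hgc a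
  refine ⟨(Integrable.integral_prod_right hint).congr (ae_of_all _ fun y ↦ hpt y), ?_⟩
  calc ∫ x : E3, (∫ y : E3, bogovskiiWeight η y ‖x - y‖ (‖x - y‖⁻¹ • (x - y)) *
        ((x - y) a * (‖x - y‖ ^ 3)⁻¹) * f y) * g x
      = ∫ x : E3, ∫ y : E3, bogovskiiWeight η y ‖x - y‖ (‖x - y‖⁻¹ • (x - y)) *
        ((x - y) a * (‖x - y‖ ^ 3)⁻¹) * f y * g x :=
        integral_congr_ae (ae_of_all _ fun x ↦ (integral_mul_const _ _).symm)
    _ = ∫ y : E3, ∫ x : E3, bogovskiiWeight η y ‖x - y‖ (‖x - y‖⁻¹ • (x - y)) *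
        ((x - y) a * (‖x - y‖ ^ 3)⁻¹) * f y * g x := integral_integral_swap hint
    _ = _ := integral_congr_ae (ae_of_all _ fun y ↦ hpt y)

/-- **Fubini, tensor kernel**: `∫ (∫ w_y(x−y)(x−y)ₐ(x−y)_b|x−y|⁻³ f(y) dy) g(x) dx = ∫ f(y) (∫ w_y(z) zₐz_b|z|⁻³ g(z + y) dz) dy`,
and the `y`-sections are integrable. [folklore] -/
theorem integral_bogovskiiK_operator_mul_eq (hη : Continuous η) (hR : ∀ z : E3, R < ‖z‖ → η z = 0)
    (hf : Continuous f) (hfc : HasCompactSupport f) (hg : Continuous g) (hgc : HasCompactSupport g) (a b : Fin 3) :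
    (Integrable fun y : E3 ↦ f y * ∫ z : E3,
      bogovskiiWeight η y ‖z‖ (‖z‖⁻¹ • z) * (z a * (z b * (‖z‖ ^ 3)⁻¹)) * g (z + y)) ∧
    ∫ x : E3, (∫ y : E3, bogovskiiWeight η y ‖x - y‖ (‖x - y‖⁻¹ • (x - y)) *
        ((x - y) a * ((x - y) b * (‖x - y‖ ^ 3)⁻¹)) * f y) * g x =
      ∫ y : E3, f y * ∫ z : E3,
        bogovskiiWeight η y ‖z‖ (‖z‖⁻¹ • z) * (z a * (z b * (‖z‖ ^ 3)⁻¹)) * g (z + y) := by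
  have hpt : ∀ y : E3, ∫ x : E3, bogovskiiWeight η y ‖x - y‖ (‖x - y‖⁻¹ • (x - y)) *
      ((x - y) a * ((x - y) b * (‖x - y‖ ^ 3)⁻¹)) * f y * g x =
      f y * ∫ z : E3, bogovskiiWeight η y ‖z‖ (‖z‖⁻¹ • z) * (z a * (z b * (‖z‖ ^ 3)⁻¹)) * g (z + y) := by
    intro y
    rw [← integral_add_right_eq_self (μ := (volume : Measure E3)) _ y, ← integral_const_mul]
    refine integral_congr_ae (ae_of_all _ fun z ↦ ?_)
    simp only [add_sub_cancel_right]
    ring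
  have hint := integrable_bogovskiiKernel_prod hη hR hf hfc hg hgc a b
  refine ⟨(Integrable.integral_prod_right hint).congr (ae_of_all _ fun y ↦ hpt y), ?_⟩
  calc ∫ x : E3, (∫ y : E3, bogovskiiWeight η y ‖x - y‖ (‖x - y‖⁻¹ • (x - y)) *
        ((x - y) a * ((x - y) b * (‖x - y‖ ^ 3)⁻¹)) * f y) * g x
      = ∫ x : E3, ∫ y : E3, bogovskiiWeight η y ‖x - y‖ (‖x - y‖⁻¹ • (x - y)) *
        ((x - y) a * ((x - y) b * (‖x - y‖ ^ 3)⁻¹)) * f y * g x :=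
        integral_congr_ae (ae_of_all _ fun x ↦ (integral_mul_const _ _).symm)
    _ = ∫ y : E3, ∫ x : E3, bogovskiiWeight η y ‖x - y‖ (‖x - y‖⁻¹ • (x - y)) *
        ((x - y) a * ((x - y) b * (‖x - y‖ ^ 3)⁻¹)) * f y * g x := integral_integral_swap hint
    _ = _ := integral_congr_ae (ae_of_all _ fun y ↦ hpt y)

end Fubini


/-! ### (T2) at the operator level -/

section Operator

/-- **Lemma 2.3, (T2) in weak form for the operator `T`.** Let `η ∈ C¹_c`, `F ∈ C_c(ℝ³; ℝ³)` with `∫ F^k = 0` and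
`∫ y_m F^j = ∫ y_j F^m` (the six Killing moment conditions), and `ψ_j ∈ C²_c`.  With the operator fields
`SV^a_k(x) = ∫ w_y(x − y)(x − y)_a|x − y|⁻³ F^k(y) dy` and `SK^{ab}_k(x) = ∫ w_y(x − y)(x − y)_a(x − y)_b|x − y|⁻³ F^k(y) dy`,
`Σ_{j,k} [δ_{jk}(½ Σ_i ∫ SV^i_k ∂ᵢψⱼ − ½ Σ_{i,m} ∫ SK^{im}_k ∂ₘ∂ᵢψⱼ) + ½ ∫ SV^j_k ∂ₖψⱼ − ½ Σ_m ∫ SK^{jm}_k ∂ₘ∂ₖψⱼ`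
`+ Σ_i ∫ SK^{ij}_k ∂ᵢ∂ₖψⱼ] = −(∫η) Σ_j ∫ F^j ψ_j`, i.e. `Σ_{i,j}⟨(T F)^{ij}, ∂ᵢψⱼ⟩ = −(∫η)⟨F, ψ⟩` for the symmetric
distribution `(T F)^{ij} = ½(SV^i_j + SV^j_i) + ½ ∂_m(SK^{im}_j + SK^{jm}_i) − ∂_k SK^{ij}_k` (module docstring).
[cite: MaoOhTao2023, Lemma 2.3 (T2)] -/
theorem sum_sum_bogovskiiVectorOperator_weak_eq (hη : ContDiff ℝ 1 η) (hR : ∀ z : E3, R < ‖z‖ → η z = 0)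
    {F : Fin 3 → E3 → ℝ} (hF : ∀ k, Continuous (F k)) (hFc : ∀ k, HasCompactSupport (F k))
    (hF0 : ∀ k, ∫ y : E3, F k y = 0) (hFA : ∀ m j : Fin 3, ∫ y : E3, y m * F j y = ∫ y : E3, y j * F m y)
    {Ψ : Fin 3 → E3 → ℝ} (hΨ : ∀ j, ContDiff ℝ 2 (Ψ j)) (hΨc : ∀ j, HasCompactSupport (Ψ j)) :
    ∑ j, ∑ k, ((if j = k then (1 : ℝ) else 0) *
        ((1 / 2 : ℝ) * (∑ i, ∫ x : E3, (∫ y : E3, bogovskiiWeight η y ‖x - y‖ (‖x - y‖⁻¹ • (x - y)) *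
            ((x - y) i * (‖x - y‖ ^ 3)⁻¹) * F k y) * pd i (Ψ j) x) -
          (1 / 2 : ℝ) * ∑ i, ∑ m, ∫ x : E3, (∫ y : E3, bogovskiiWeight η y ‖x - y‖ (‖x - y‖⁻¹ • (x - y)) *
            ((x - y) i * ((x - y) m * (‖x - y‖ ^ 3)⁻¹)) * F k y) * pd m (pd i (Ψ j)) x) +
      (1 / 2 : ℝ) * (∫ x : E3, (∫ y : E3, bogovskiiWeight η y ‖x - y‖ (‖x - y‖⁻¹ • (x - y)) *
          ((x - y) j * (‖x - y‖ ^ 3)⁻¹) * F k y) * pd k (Ψ j) x) -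
      (1 / 2 : ℝ) * (∑ m, ∫ x : E3, (∫ y : E3, bogovskiiWeight η y ‖x - y‖ (‖x - y‖⁻¹ • (x - y)) *
          ((x - y) j * ((x - y) m * (‖x - y‖ ^ 3)⁻¹)) * F k y) * pd m (pd k (Ψ j)) x) +
      ∑ i, ∫ x : E3, (∫ y : E3, bogovskiiWeight η y ‖x - y‖ (‖x - y‖⁻¹ • (x - y)) *
          ((x - y) i * ((x - y) j * (‖x - y‖ ^ 3)⁻¹)) * F k y) * pd i (pd k (Ψ j)) x) =
      -((∫ z : E3, η z) * ∑ j, ∫ y : E3, F j y * Ψ j y) := by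
  have hηc : Continuous η := hη.continuous
  refine Eq.trans ?_ (sum_sum_integral_mul_bogovskiiT_weak_eq hη hR hF hFc hF0 hFA hΨ hΨc)
  refine Finset.sum_congr rfl fun j _ ↦ Finset.sum_congr rfl fun k _ ↦ ?_
  -- regularity of the test-function derivatives
  have hg1 : ∀ i, Continuous (pd i (Ψ j)) := fun i ↦
    ((hΨ j).continuous_fderiv two_ne_zero).clm_apply continuous_const
  have hg1c : ∀ i, HasCompactSupport (pd i (Ψ j)) := fun i ↦ hasCompactSupport_pd (hΨc j) i
  have hg2 : ∀ i m, Continuous (pd m (pd i (Ψ j))) := fun i m ↦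
    ((contDiff_pd (n := 1) (hΨ j) i).continuous_fderiv one_ne_zero).clm_apply continuous_const
  have hg2c : ∀ i m, HasCompactSupport (pd m (pd i (Ψ j))) := fun i m ↦
    hasCompactSupport_pd (hasCompactSupport_pd (hΨc j) i) m
  -- Fubini for the five families of terms
  have h1 := fun i ↦ integral_bogovskiiV_operator_mul_eq hηc hR (hF k) (hFc k) (hg1 i) (hg1c i) i
  have h2 := fun i m ↦ integral_bogovskiiK_operator_mul_eq hηc hR (hF k) (hFc k) (hg2 i m) (hg2c i m) i m
  have h3 := integral_bogovskiiV_operator_mul_eq hηc hR (hF k) (hFc k) (hg1 k) (hg1c k) j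
  have h4 := fun m ↦ integral_bogovskiiK_operator_mul_eq hηc hR (hF k) (hFc k) (hg2 k m) (hg2c k m) j m
  have h5 := fun i ↦ integral_bogovskiiK_operator_mul_eq hηc hR (hF k) (hFc k) (hg2 k i) (hg2c k i) i j
  rw [Finset.sum_congr rfl fun i _ ↦ (h1 i).2,
    Finset.sum_congr rfl fun i _ ↦ Finset.sum_congr rfl fun m _ ↦ (h2 i m).2, h3.2,
    Finset.sum_congr rfl fun m _ ↦ (h4 m).2, Finset.sum_congr rfl fun i _ ↦ (h5 i).2]
  -- abbreviations for the `y`-sections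
  set G1 : Fin 3 → E3 → ℝ := fun i y ↦ ∫ z : E3,
    bogovskiiWeight η y ‖z‖ (‖z‖⁻¹ • z) * (z i * (‖z‖ ^ 3)⁻¹) * pd i (Ψ j) (z + y) with hG1
  set G2 : Fin 3 → Fin 3 → E3 → ℝ := fun i m y ↦ ∫ z : E3,
    bogovskiiWeight η y ‖z‖ (‖z‖⁻¹ • z) * (z i * (z m * (‖z‖ ^ 3)⁻¹)) * pd m (pd i (Ψ j)) (z + y) with hG2
  set G3 : E3 → ℝ := fun y ↦ ∫ z : E3,
    bogovskiiWeight η y ‖z‖ (‖z‖⁻¹ • z) * (z j * (‖z‖ ^ 3)⁻¹) * pd k (Ψ j) (z + y) with hG3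
  set G4 : Fin 3 → E3 → ℝ := fun m y ↦ ∫ z : E3,
    bogovskiiWeight η y ‖z‖ (‖z‖⁻¹ • z) * (z j * (z m * (‖z‖ ^ 3)⁻¹)) * pd m (pd k (Ψ j)) (z + y) with hG4
  set G5 : Fin 3 → E3 → ℝ := fun i y ↦ ∫ z : E3,
    bogovskiiWeight η y ‖z‖ (‖z‖⁻¹ • z) * (z i * (z j * (‖z‖ ^ 3)⁻¹)) * pd i (pd k (Ψ j)) (z + y) with hG5
  set G6 : Fin 3 → E3 → ℝ := fun m y ↦ ∫ z : E3,
    bogovskiiWeight η y ‖z‖ (‖z‖⁻¹ • z) * (z m * (‖z‖ ^ 3)⁻¹) * (z j * pd m (pd k (Ψ j)) (z + y)) with hG6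
  set δ : ℝ := if j = k then 1 else 0 with hδ
  show δ * ((1 / 2 : ℝ) * (∑ i, ∫ y : E3, F k y * G1 i y) - (1 / 2 : ℝ) * ∑ i, ∑ m, ∫ y : E3, F k y * G2 i m y) +
      (1 / 2 : ℝ) * (∫ y : E3, F k y * G3 y) - (1 / 2 : ℝ) * (∑ m, ∫ y : E3, F k y * G4 m y) +
      ∑ i, ∫ y : E3, F k y * G5 i y =
    ∫ y : E3, F k y * (δ * ((1 / 2 : ℝ) * (∑ i, G1 i y) - (1 / 2 : ℝ) * ∑ i, ∑ m, G2 i m y) +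
      (1 / 2 : ℝ) * G3 y - (1 / 2 : ℝ) * (∑ m, G6 m y) + ∑ i, G6 i y)
  -- the differently associated sections agree
  have h64 : G6 = G4 := by
    funext m y
    exact integral_congr_ae (ae_of_all _ fun z ↦ by simp only; ring)
  have h54 : G5 = G4 := by
    funext m y
    exact integral_congr_ae (ae_of_all _ fun z ↦ by simp only; ring)
  rw [h64, h54]
  -- integrability of the sections against `F^k`
  have I1 : ∀ i, Integrable fun y : E3 ↦ F k y * G1 i y := fun i ↦ (h1 i).1
  have I2 : ∀ i m, Integrable fun y : E3 ↦ F k y * G2 i m y := fun i m ↦ (h2 i m).1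
  have I3 : Integrable fun y : E3 ↦ F k y * G3 y := h3.1
  have I4 : ∀ m, Integrable fun y : E3 ↦ F k y * G4 m y := fun m ↦ (h4 m).1
  -- linearity of the `y`-integral
  have J1 : Integrable fun y : E3 ↦ ∑ i, F k y * G1 i y := integrable_finsetSum _ fun i _ ↦ I1 i
  have J2 : Integrable fun y : E3 ↦ ∑ i, ∑ m, F k y * G2 i m y :=
    integrable_finsetSum _ fun i _ ↦ integrable_finsetSum _ fun m _ ↦ I2 i m
  have J4 : Integrable fun y : E3 ↦ ∑ m, F k y * G4 m y := integrable_finsetSum _ fun m _ ↦ I4 m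
  have JB : Integrable fun y : E3 ↦ δ * ((1 / 2 : ℝ) * (∑ i, F k y * G1 i y) -
      (1 / 2 : ℝ) * ∑ i, ∑ m, F k y * G2 i m y) := ((J1.const_mul _).sub (J2.const_mul _)).const_mul _
  have JC : Integrable fun y : E3 ↦ δ * ((1 / 2 : ℝ) * (∑ i, F k y * G1 i y) -
      (1 / 2 : ℝ) * ∑ i, ∑ m, F k y * G2 i m y) + (1 / 2 : ℝ) * (F k y * G3 y) := JB.add (I3.const_mul _)
  have JD : Integrable fun y : E3 ↦ δ * ((1 / 2 : ℝ) * (∑ i, F k y * G1 i y) -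
      (1 / 2 : ℝ) * ∑ i, ∑ m, F k y * G2 i m y) + (1 / 2 : ℝ) * (F k y * G3 y) -
      (1 / 2 : ℝ) * ∑ m, F k y * G4 m y := JC.sub (J4.const_mul _)
  have hpt : ∀ y : E3, F k y * (δ * ((1 / 2 : ℝ) * (∑ i, G1 i y) - (1 / 2 : ℝ) * ∑ i, ∑ m, G2 i m y) +
      (1 / 2 : ℝ) * G3 y - (1 / 2 : ℝ) * (∑ m, G4 m y) + ∑ i, G4 i y) =
      δ * ((1 / 2 : ℝ) * (∑ i, F k y * G1 i y) - (1 / 2 : ℝ) * ∑ i, ∑ m, F k y * G2 i m y) +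
        (1 / 2 : ℝ) * (F k y * G3 y) - (1 / 2 : ℝ) * (∑ m, F k y * G4 m y) + ∑ i, F k y * G4 i y := by
    intro y
    simp only [← Finset.mul_sum]
    ring
  symm
  rw [integral_congr_ae (ae_of_all _ hpt), integral_add JD J4, integral_sub JC (J4.const_mul _),
    integral_add JB (I3.const_mul _), integral_const_mul, integral_sub (J1.const_mul _) (J2.const_mul _),
    integral_const_mul, integral_const_mul, integral_const_mul, integral_const_mul,
    integral_finsetSum _ fun i _ ↦ I1 i, integral_finsetSum _ fun i _ ↦ integrable_finsetSum _ fun m _ ↦ I2 i m,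
    Finset.sum_congr rfl fun i _ ↦ integral_finsetSum _ fun m _ ↦ I2 i m,
    integral_finsetSum _ fun m _ ↦ I4 m]

/-- **Lemma 2.3, (T1) for the vector operator field `SV`.** If `Ω` is star-shaped with respect to every point of
`B ⊇ supp η` and `supp f ⊆ Ω`, then `SV^a f (x) = ∫ w_y(x − y)(x − y)_a|x − y|⁻³ f(y) dy = 0` for `x ∉ Ω`.
[cite: MaoOhTao2023, Lemma 2.3 (T1)] -/
theorem integral_bogovskiiV_mul_eq_zero_of_notMem {Ω B : Set E3} (hΩ : ∀ b ∈ B, StarConvex ℝ b Ω)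
    (hηB : ∀ z, η z ≠ 0 → z ∈ B) {f : E3 → ℝ} (hfΩ : ∀ y, f y ≠ 0 → y ∈ Ω) {x : E3} (hx : x ∉ Ω)
    (a : Fin 3) :
    ∫ y : E3, bogovskiiWeight η y ‖x - y‖ (‖x - y‖⁻¹ • (x - y)) * ((x - y) a * (‖x - y‖ ^ 3)⁻¹) * f y = 0 := by
  refine integral_eq_zero_of_ae (ae_of_all _ fun y ↦ ?_)
  by_contra h
  rcases mul_ne_zero_iff.1 h with ⟨hΨ, hfy⟩
  rcases mul_ne_zero_iff.1 hΨ with ⟨hw, hza⟩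
  have hz : x - y ≠ 0 := by
    intro h0
    rw [h0] at hza
    simp at hza
  have := add_mem_of_bogovskiiWeight_ne_zero hΩ hηB (hfΩ y hfy) hz hw
  rw [sub_add_cancel] at this
  exact hx this

/-- (T1) in support form: `supp SV^a f ⊆ Ω` (and `supp SK^{ab} f ⊆ Ω` is `support_bogovskiiOperator_subset`).
[cite: MaoOhTao2023, Lemma 2.3 (T1)] -/
theorem support_bogovskiiV_operator_subset {Ω B : Set E3} (hΩ : ∀ b ∈ B, StarConvex ℝ b Ω)
    (hηB : ∀ z, η z ≠ 0 → z ∈ B) {f : E3 → ℝ} (hfΩ : ∀ y, f y ≠ 0 → y ∈ Ω) (a : Fin 3) :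
    support (fun x : E3 ↦ ∫ y : E3, bogovskiiWeight η y ‖x - y‖ (‖x - y‖⁻¹ • (x - y)) *
        ((x - y) a * (‖x - y‖ ^ 3)⁻¹) * f y) ⊆ Ω := by
  intro x hx
  by_contra hxΩ
  exact hx (integral_bogovskiiV_mul_eq_zero_of_notMem hΩ hηB hfΩ hxΩ a)

end Operator

end MaoOhTao

end Literature.Geometry.Lorentzian

end
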